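import Literature.AlgebraicGeometry.Motives.CartierDivisorIdealSheaf
import Literature.AlgebraicGeometry.Motives.CartierDivisorCurveDegree
import Literature.AlgebraicGeometry.Resolution.StrictTransformIsBlowup
import HarnessLib

/-!
# The closed subscheme of a pulled-back effective Cartier divisor is the scheme-theoretic preimage

Görtz–Wedhorn, *Algebraic Geometry I*, Remark 11.27 / (11.12) (pp. 305–306) identify an effective Cartier divisor `D = (U_i, f_i)`
with the closed subscheme `Z(D)` of ideal `𝒪_X(−D)`, `Z(D) ∩ U_i = V(f_i)`; Prop. 11.50 / Def. 11.49 (pp. 315–316; 1st ed. (11.16)) pull `D`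
back along a morphism `g : Y → X` whose image is not contained in `Supp D` to `g^*D = (g⁻¹U_i, g^♯ f_i)`; and §(4.11) with
Example 4.36 (p. 112) compute scheme-theoretic preimages of closed subschemes chart-wise: «`f⁻¹(V(𝔞)) = V(𝔞B)`».  Put together:

  **`Z(g^*D) = g⁻¹(Z(D)) = Y ×_X Z(D)`** as closed subschemes of `Y`.

In the tree՚s currency (`Motives/CartierDivisor`: tuples `(U_i, f_i)`; `Motives/CartierDivisorIdealSheaf`: `hD.idealSheaf = 𝒪_X(−D)` as a
Mathlib `IdealSheafData`, whose `subscheme` is `Z(D)`; `Motives/CartierDivisorClassPullback`: `D.pullbackAvoiding g hg` along an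
ARBITRARY morphism of integral schemes with `g(η_Y) ∉ Supp D`, `D.pullback g` along a dominant one) this file proves:

* `CartierDivisor.SameDivisor.idealSheaf_eq` — two presentations of the same effective divisor have the same ideal sheaf
  (converse of ★ `SameDivisor.of_idealSheaf_eq`);
* `CartierDivisor.IsEffective.idealSheaf_pullbackAvoiding` — **`𝒪_Y(−g^*D) = (𝒪_X(−D))·𝒪_Y`**, i.e.
  `(hD.pullbackAvoiding g hg).idealSheaf = hD.idealSheaf.comap g` (Mathlib `IdealSheafData.comap` = the ideal of `Y ×_X Z(D) ↪ Y`);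
  `CartierDivisor.IsEffective.idealSheaf_pullback` — the same for the dominant pull-back;
* `CartierDivisor.IsEffective.nonempty_subscheme_pullbackAvoiding_iso_pullback` — hence **`Z(g^*D) ≅ Y ×_X Z(D)`** over `Y`
  (Mathlib `IdealSheafData.comapIso`), and `…isPullback_subscheme_pullbackAvoiding` — the cartesian square
  `Z(g^*D) → Z(D)`, `Z(g^*D) ↪ Y → X`.

Everything is a theorem (no definition, no named fact, no `sorry`).  Use: leaf (P3-i) of the «fibre dictionary» of Step I of
[Lange2023 Lem. 4.4.4] = [Milne1986 Lem. 6.7] on road (E) of the cell `hodgecm-mathlib` (crux HLiu418 = stmt-HodgeConjecture-24832):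
the fibre of `ψ : C × W̃ → J` over `a` is `ι_a⁻¹(Z(Θ)) = Z(ι_a^*Θ)`.  COUNT-NEUTRAL.  HC_CM is proved only modulo the 7 printed citations
until rung 0 closes.

Mathlib searched (pin): `Scheme.IdealSheafData.comap`, `comapIso`, `comapIso_hom_fst`, `ext_of_iSup_eq_top`, `Scheme.Hom.appLE`,
`Scheme.Hom.germ_stalkMap_apply`, `exists_isAffineOpen_mem_and_subset`, `Ideal.map_span` (all used); Mathlib has no Cartier divisors.

## References

* U. Görtz, T. Wedhorn, *Algebraic Geometry I: Schemes*, 2nd ed., Springer Spektrum (2020): Remark 11.27 and (11.12) (pp. 305–306),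
  Def. 11.49 / Prop. 11.50 (pp. 315–316), §(4.11) and Example 4.36 (p. 112). [GortzWedhorn2020]
* The Stacks Project, Tag 01WV (pullback of effective Cartier divisors, Divisors Lemma 31.13.13) and Tag 02ND. [StacksProject]
-/

noncomputable section

open CategoryTheory CategoryTheory.Limits AlgebraicGeometry TopologicalSpace Opposite

universe u

namespace Literature.AlgebraicGeometry.Motives

namespace CartierDivisor

open RatFn

variable {X : Scheme.{u}} [IsIntegral X] {D E : CartierDivisor X}

/-! ## Presentations of the same divisor have the same ideal sheaf -/

/-- The sections of `𝒪_X(−D)` over an affine open only depend on the divisor, not on the presentation `(U_i, f_i)`: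
`f_i / g_j ∈ 𝒪_{X,x}^×` on `U_i ∩ V_j` (Görtz–Wedhorn I, Def. 11.20). [cite: GortzWedhorn2020, Def. 11.20 (p. 301) and Remark 11.27 (p. 305)] -/
theorem SameDivisor.sectionIdeal_le (h : D.SameDivisor E) (V : X.affineOpens) :
    D.sectionIdeal V ≤ E.sectionIdeal V := by
  intro s hs j y hy hyj
  obtain ⟨i, hyi⟩ := D.covers y
  have e : secFn hy s / D.f i * (D.f i / E.f j) = secFn hy s / E.f j := by
    rw [← mul_div_assoc, div_mul_cancel₀ _ (D.f_ne_zero i)]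
  rw [← e]
  exact (hs i y hy hyi).mul (h i j y hyi hyj).isRegularAt

/-- **Two presentations of the same effective Cartier divisor have the same ideal sheaf `𝒪_X(−D)`** (converse of
`SameDivisor.of_idealSheaf_eq`). [cite: GortzWedhorn2020, Def. 11.20 (p. 301) and Remark 11.27 (p. 305)] -/
theorem SameDivisor.idealSheaf_eq (h : D.SameDivisor E) (hD : D.IsEffective) (hE : E.IsEffective) :
    hD.idealSheaf = hE.idealSheaf := by
  refine le_antisymm (fun V => ?_) (fun V => ?_)
  · rw [hD.ideal_idealSheaf, hE.ideal_idealSheaf]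
    exact h.sectionIdeal_le V
  · rw [hD.ideal_idealSheaf, hE.ideal_idealSheaf]
    exact h.symm.sectionIdeal_le V

/-! ## The ideal sheaf of a pulled-back divisor is the pulled-back ideal sheaf -/

section Pullback

variable {Y : Scheme.{u}} [IsIntegral Y] (g : Y ⟶ X)

/-- The rational function of the pulled-back section `g^*t|_{W'}` (`W' ⊆ g⁻¹W`) is the pull-back `g^♯` of the rational function of
`t` (compatibility of `RatFn.pullbackFn` with the stalk maps, ★ `pullbackFn_toFunctionField`; Görtz–Wedhorn I, Prop. 3.29: sections as
rational functions). [cite: GortzWedhorn2020, Prop. 3.29 (p. 80)] -/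
theorem secFn_appLE_eq_pullbackFn {W : X.Opens} {W' : Y.Opens} (hW' : W' ≤ g ⁻¹ᵁ W) {y : Y} (hy : y ∈ W')
    (t : Γ(X, W)) : secFn hy (g.appLE W W' hW' t) = pullbackFn g (secFn (hW' hy) t) := by
  have hgy : g y ∈ W := hW' hy
  rw [← toFunctionField_germ_eq_secFn hgy hgy t, pullbackFn_toFunctionField,
    Scheme.Hom.germ_stalkMap_apply, ← toFunctionField_germ_eq_secFn hy hy]
  congr 1
  change (Y.presheaf.germ W' y hy) ((g.app W ≫ Y.presheaf.map (homOfLE hW').op) t) = _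
  rw [CommRingCat.comp_apply, TopCat.Presheaf.germ_res_apply]

/-- The image of the generic point of `Y` lies in every chart `U_i` through `g(y)` (it specialises to `g(y)`). [folklore] -/
private theorem apply_genericPoint_mem_of_apply_mem {i : D.ι} {y : Y} (hyi : g y ∈ D.U i) : g (genericPoint Y) ∈ D.U i :=
  (g.base.hom.map_specializes ((genericPoint_spec Y).specializes (Set.mem_univ y))).mem_open (D.U i).2 hyi

/-- **`𝒪_Y(−g^*D) = 𝒪_X(−D) · 𝒪_Y`**: the ideal sheaf of the pull-back `g^*D` of an effective Cartier divisor along a morphism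
`g : Y → X` of integral schemes with `g(η_Y) ∉ Supp D` is the pull-back (Mathlib `IdealSheafData.comap`, the ideal of
`Y ×_X Z(D) ↪ Y`) of the ideal sheaf of `D`.  Chart-wise: on an affine `W' ⊆ g⁻¹W`, `W ⊆ U_i` affine with `f_i = t ∈ Γ(W, 𝒪_X)`,
both ideals are `(g^*t) ⊆ Γ(W', 𝒪_Y)` (★ `sectionIdeal_eq_span`, ★ `ideal_comap_eq_map_of_le` = Görtz–Wedhorn I, Example 4.36).
[cite: GortzWedhorn2020, Remark 11.27 (p. 305), Def. 11.49 / Prop. 11.50 (pp. 315–316) and Example 4.36 (p. 112)]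
[cite: StacksProject, Tag 01WV] -/
theorem IsEffective.idealSheaf_pullbackAvoiding (hD : D.IsEffective) (hg : D.Avoids (g (genericPoint Y))) :
    (hD.pullbackAvoiding g hg).idealSheaf = hD.idealSheaf.comap g := by
  -- every point of `Y` has an affine neighbourhood on which the two ideals agree
  have key : ∀ y : Y, ∃ W' : Y.affineOpens, y ∈ (W' : Y.Opens) ∧
      (hD.pullbackAvoiding g hg).idealSheaf.ideal W' = (hD.idealSheaf.comap g).ideal W' := by
    intro y
    obtain ⟨i, hyi⟩ := D.covers (g y)
    obtain ⟨W, hgyW, hWi, -, t, ht⟩ := hD.exists_affine_secFn_eq hyi (O := ⊤) trivial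
    obtain ⟨W'₀, hW'₀, hyW', hW'le⟩ := exists_isAffineOpen_mem_and_subset (X := Y) (x := y) (U := g ⁻¹ᵁ (W : X.Opens)) hgyW
    let W' : Y.affineOpens := ⟨W'₀, hW'₀⟩
    have hle : (W' : Y.Opens) ≤ g ⁻¹ᵁ (W : X.Opens) := hW'le
    refine ⟨W', hyW', ?_⟩
    -- the pulled-back ideal: `𝒪_X(−D)(W) · Γ(W') = (g^* t)`
    rw [Literature.AlgebraicGeometry.Resolution.ideal_comap_eq_map_of_le g hD.idealSheaf W W' hle,
      hD.ideal_idealSheaf, sectionIdeal_eq_span hgyW hWi ht, Ideal.map_span, Set.image_singleton]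
    -- the ideal of `g^*D`: chart `g⁻¹U_i ⊇ W'`, local equation `g^♯ f_i`, which is the section `g^* t` on `W'`
    rw [(hD.pullbackAvoiding g hg).ideal_idealSheaf]
    have hi : g (genericPoint Y) ∈ D.U i := apply_genericPoint_mem_of_apply_mem g hyi
    refine sectionIdeal_eq_span (D := D.pullbackAvoiding g hg) hyW' (i := ⟨i, hi⟩)
      (fun z hz => show g z ∈ D.U i from hWi (hle hz)) ?_
    rw [pullbackAvoiding_f, secFn_appLE_eq_pullbackFn g hle hyW' t, ht]
  choose W' hyW' hW' using key
  exact Scheme.IdealSheafData.ext_of_iSup_eq_top W'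
    (top_le_iff.mp fun y _ => Opens.mem_iSup.mpr ⟨y, hyW' y⟩) hW'

/-- **`𝒪_Y(−g^*D) = 𝒪_X(−D) · 𝒪_Y` for a dominant `g`** (the pull-back `D.pullback g` of `Motives/CartierDivisor`, which is the same
divisor as `D.pullbackAvoiding g _`, ★ `pullbackAvoiding_sameDivisor_pullback`). [cite: GortzWedhorn2020, Def. 11.49 / Prop. 11.50 (pp. 315–316) and Example 4.36 (p. 112)] -/
theorem IsEffective.idealSheaf_pullback (hD : D.IsEffective) [IsDominant g] :
    (hD.pullback g).idealSheaf = hD.idealSheaf.comap g := by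
  have hg : D.Avoids (g (genericPoint Y)) := D.avoids_apply_genericPoint g
  rw [← hD.idealSheaf_pullbackAvoiding g hg]
  exact ((pullbackAvoiding_sameDivisor_pullback g D hg).idealSheaf_eq _ _).symm

/-! ## `Z(g^*D) ≅ Y ×_X Z(D)` -/

/-- **`Z(g^*D) ≅ Y ×_X Z(D)` over `Y`**: the closed subscheme of the pulled-back effective Cartier divisor is the scheme-theoretic
preimage of `Z(D)` — an isomorphism with the fibre product commuting with the inclusions into `Y` (Mathlib `IdealSheafData.comapIso`).
[cite: GortzWedhorn2020, Remark 11.27 (p. 305), Prop. 11.50 (pp. 315–316) and §(4.11) (p. 112)] [cite: StacksProject, Tag 01WV] -/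
theorem IsEffective.nonempty_subscheme_pullbackAvoiding_iso_pullback (hD : D.IsEffective)
    (hg : D.Avoids (g (genericPoint Y))) :
    ∃ e : (hD.pullbackAvoiding g hg).idealSheaf.subscheme ≅ Limits.pullback g hD.idealSheaf.subschemeι,
      e.hom ≫ Limits.pullback.fst g hD.idealSheaf.subschemeι = (hD.pullbackAvoiding g hg).idealSheaf.subschemeι := by
  -- transport Mathlib's `comapIso` along the equality of ideal sheaves
  rw [hD.idealSheaf_pullbackAvoiding g hg]
  exact ⟨hD.idealSheaf.comapIso g, hD.idealSheaf.comapIso_hom_fst g⟩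

/-- **The cartesian square `Z(g^*D) → Z(D)` over `g : Y → X`**: the restriction of `g` to the closed subschemes
(Mathlib `IdealSheafData.subschemeMap`, available since `𝒪_X(−D)·𝒪_Y = 𝒪_Y(−g^*D)`) makes `Z(g^*D)` the fibre product `Y ×_X Z(D)`.
[cite: GortzWedhorn2020, Remark 11.27 (p. 305), Prop. 11.50 (pp. 315–316) and §(4.11) (p. 112)] [cite: StacksProject, Tag 01WV] -/
theorem IsEffective.isPullback_subscheme_pullbackAvoiding (hD : D.IsEffective) (hg : D.Avoids (g (genericPoint Y))) :
    IsPullback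
      ((hD.pullbackAvoiding g hg).idealSheaf.subschemeι)
      (Scheme.IdealSheafData.subschemeMap _ hD.idealSheaf g
        ((hD.idealSheaf.le_map_comap g).trans_eq (congrArg (Scheme.IdealSheafData.map · g)
          (hD.idealSheaf_pullbackAvoiding g hg).symm)))
      g hD.idealSheaf.subschemeι := by
  -- generalise the ideal sheaf of `g^*D` (and the proof riding on it), then use Mathlib's `comapIso`
  suffices H : ∀ (I : Y.IdealSheafData), I = hD.idealSheaf.comap g → ∀ (hle : hD.idealSheaf ≤ I.map g),
      IsPullback I.subschemeι (Scheme.IdealSheafData.subschemeMap I hD.idealSheaf g hle) g hD.idealSheaf.subschemeι from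
    H _ (hD.idealSheaf_pullbackAvoiding g hg) _
  rintro I rfl hle
  exact IsPullback.of_iso_pullback ⟨(Scheme.IdealSheafData.subschemeMap_subschemeι _ _ g hle).symm⟩
    (hD.idealSheaf.comapIso g) (hD.idealSheaf.comapIso_hom_fst g) (hD.idealSheaf.comapIso_hom_snd g)

end Pullback

end CartierDivisor

end Literature.AlgebraicGeometry.Motives

end
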